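import Summits.AnomalousDissipation.AnomalousDissipation.Theorems.SawtoothPulseCascadeK1LocalisedCascadeKHBlochPoly

/-!
# K2 lane (route-2 `SawtoothPulseCascade`, crux dir `K1LocalisedCascade`): the Bloch `H¹–H⁻¹` duality on one period — Bessel, integration by parts, weighted Cauchy–Schwarz

Helper file of the K2 lane (ACL item stmt-AnomalousDissipation-19491; arbiter A28-11: the CORNER LAW `CoreStripLaw a₀ C`, p2 g13).  The input energy of a
transverse profile `g(y) = Σ_{|n| ≤ K} c_n e^{2πi(b+n)y}` on the line `a` is the `H⁻¹`-type quantity `Σ_n |c_n|²/(a² + (b+n)²)`; every source functional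
of the kink-sheet block is `∫_{−½}^{½} F(y) g(y) dy` for an explicit kernel-times-phase `F`.  This file proves the abstract duality estimate that turns such a
functional into `√(input energy) × √(a²∫|F|² + ∫|F'|²/(4π²))`:
* `sum_sq_coeff_le_of_bound` — finite Bessel for a BOUNDED a.e.-measurable interior on `(−½, ½]` (from the tree's Parseval `hasSum_sq_coeff_of_bound`,
  `…KHBlochPoly`; derivatives of the kernel are only piecewise continuous);
* `two_pi_mul_coeff_eq_coeff_deriv` — integration by parts on one period for a continuous, piecewise-`C¹` `F` satisfying the BLOCH CONDITION
  `F(½) = e^{2πiβ} F(−½)`: `2πi(β+n)·∫F e^{−2πi(β+n)y} = ∫F' e^{−2πi(β+n)y}` (no boundary term);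
* `sum_weight_sq_coeff_le` — **`Σ_{n∈S} (a² + (β+n)²)|∫F e^{−2πi(β+n)y}|² ≤ a²∫|F|² + (1/4π²)∫|F'|²`** for every finite `S`;
* `norm_sum_mul_coeff_le` — the duality bound `|Σ_{n∈S} c_n ∫F e^{−2πi(β+n)y}| ≤ √(Σ|c_n|²/(a²+(β+n)²))·√(a²∫|F|² + ∫|F'|²/(4π²))`;
* the same two statements for the `e^{+2πi(b+n)y}` family (`…_pos`, Bloch condition `F(½) = e^{−2πib}F(−½)`), which is the form the corner law uses.
No definitions; no statement about the crux. [folklore] [problem: turb]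
-/

-- `Summit.<Summit>.<Problem>`: single-conjunct summit, the duplicate namespace segment is deliberate.
set_option linter.dupNamespace false

noncomputable section

namespace Summit.AnomalousDissipation.AnomalousDissipation.Theorems.SawtoothPulseCascade.K2PhaseBudget

open Set MeasureTheory intervalIntegral

/-! ## §1 Parseval / Bessel for bounded measurable interiors -/

/-- **Finite Bessel:** `Σ_{n∈S} |∫_{−½}^{½} g(y)e^{−2πi(β+n)y} dy|² ≤ ∫_{−½}^{½} |g|²` for a bounded interior (a.e.-strongly measurable on `(−½, ½]`)
and every finite set of modes (tree Parseval `hasSum_sq_coeff_of_bound`). [folklore] -/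
theorem sum_sq_coeff_le_of_bound {g : ℝ → ℂ} {C : ℝ}
    (hg : AEStronglyMeasurable g (volume.restrict (Ioc (-(1 / 2 : ℝ)) (1 / 2)))) (hb : ∀ y, ‖g y‖ ≤ C) (β : ℝ) (S : Finset ℤ) :
    ∑ n ∈ S, ‖∫ y in (-(1 / 2 : ℝ))..(1 / 2), g y * Complex.exp (-(2 * Real.pi * (β + n) * y : ℝ) * Complex.I)‖ ^ 2 ≤
      ∫ y in (-(1 / 2 : ℝ))..(1 / 2), ‖g y‖ ^ 2 :=
  sum_le_hasSum S (fun n _ => by positivity) (hasSum_sq_coeff_of_bound hg hb β)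

/-! ## §2 Integration by parts on one period under the Bloch condition -/

/-- The character `y ↦ e^{−iωy}` and its derivative `−iω e^{−iωy}`. [folklore] -/
theorem hasDerivAt_blochChar (ω y : ℝ) :
    HasDerivAt (fun y : ℝ => Complex.exp (-(ω * y : ℝ) * Complex.I))
      (-((ω : ℝ) : ℂ) * Complex.I * Complex.exp (-(ω * y : ℝ) * Complex.I)) y := by
  have h1 : HasDerivAt (fun y : ℝ => ((y : ℝ) : ℂ)) ((1 : ℝ) : ℂ) y := (hasDerivAt_id y).ofReal_comp
  have h2 : HasDerivAt (fun y : ℝ => -((ω : ℝ) : ℂ) * Complex.I * ((y : ℝ) : ℂ)) (-((ω : ℝ) : ℂ) * Complex.I * ((1 : ℝ) : ℂ)) y :=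
    h1.const_mul _
  have h3 := h2.cexp
  have e : (fun y : ℝ => Complex.exp (-((ω : ℝ) : ℂ) * Complex.I * ((y : ℝ) : ℂ))) = fun y : ℝ => Complex.exp (-(ω * y : ℝ) * Complex.I) := by
    funext y; congr 1; push_cast; ring
  rw [e] at h3
  refine h3.congr_deriv ?_
  push_cast; ring

/-- **Integration by parts on one period, no boundary term:** for `F` continuous on `[−½, ½]`, differentiable off a countable set with an integrable
derivative `F'`, and satisfying the BLOCH CONDITION `F(½) = e^{2πiβ} F(−½)`, one has `2πi(β+n)·∫_{−½}^{½} F e^{−2πi(β+n)y} = ∫_{−½}^{½} F' e^{−2πi(β+n)y}`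
for every `n ∈ ℤ` (the boundary term `[F e^{−2πi(β+n)y}]_{−½}^{½}` vanishes because `e^{2πin} = 1`). [folklore] -/
theorem two_pi_mul_coeff_eq_coeff_deriv {F F' : ℝ → ℂ} {β : ℝ} {T : Set ℝ} (hT : T.Countable)
    (hF : ContinuousOn F (Icc (-(1 / 2 : ℝ)) (1 / 2)))
    (hd : ∀ y ∈ Ioo (-(1 / 2 : ℝ)) (1 / 2) \ T, HasDerivAt F (F' y) y)
    (hi : IntervalIntegrable F' volume (-(1 / 2 : ℝ)) (1 / 2))
    (hbloch : F (1 / 2) = Complex.exp (((2 * Real.pi * β : ℝ) : ℂ) * Complex.I) * F (-(1 / 2))) (n : ℤ) :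
    ((2 * Real.pi * (β + n) : ℝ) : ℂ) * Complex.I *
        ∫ y in (-(1 / 2 : ℝ))..(1 / 2), F y * Complex.exp (-(2 * Real.pi * (β + n) * y : ℝ) * Complex.I) =
      ∫ y in (-(1 / 2 : ℝ))..(1 / 2), F' y * Complex.exp (-(2 * Real.pi * (β + n) * y : ℝ) * Complex.I) := by
  set ω : ℝ := 2 * Real.pi * (β + n) with hω
  set e : ℝ → ℂ := fun y => Complex.exp (-(ω * y : ℝ) * Complex.I) with he
  have hec : Continuous e := by rw [he]; fun_prop
  have hde : ∀ y : ℝ, HasDerivAt e (-((ω : ℝ) : ℂ) * Complex.I * e y) y := fun y => hasDerivAt_blochChar ω y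
  -- the product `H = F·e` and its derivative off `T`
  set H : ℝ → ℂ := fun y => F y * e y with hH
  set H' : ℝ → ℂ := fun y => F' y * e y + F y * (-((ω : ℝ) : ℂ) * Complex.I * e y) with hH'
  have hHc : ContinuousOn H (Icc (-(1 / 2 : ℝ)) (1 / 2)) := hF.mul hec.continuousOn
  have hHd : ∀ y ∈ Ioo (-(1 / 2 : ℝ)) (1 / 2) \ T, HasDerivAt H (H' y) y := fun y hy => (hd y hy).mul (hde y)
  have hI1 : IntervalIntegrable (fun y => F' y * e y) volume (-(1 / 2 : ℝ)) (1 / 2) := hi.mul_continuousOn hec.continuousOn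
  have hI2 : IntervalIntegrable (fun y => F y * (-((ω : ℝ) : ℂ) * Complex.I * e y)) volume (-(1 / 2 : ℝ)) (1 / 2) := by
    refine ContinuousOn.intervalIntegrable ?_
    rw [uIcc_of_le (by norm_num)]
    exact hF.mul ((continuous_const.mul hec).continuousOn)
  have hHi : IntervalIntegrable H' volume (-(1 / 2 : ℝ)) (1 / 2) := hI1.add hI2
  have hFTC := integral_eq_of_hasDerivAt_off_countable_of_le H H' (by norm_num) hT hHc hHd hHi
  -- the boundary term vanishes
  have hbd : H (1 / 2) - H (-(1 / 2)) = 0 := by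
    simp only [hH, he]
    rw [hbloch]
    have e1 : Complex.exp (((2 * Real.pi * β : ℝ) : ℂ) * Complex.I) * Complex.exp (-(ω * (1 / 2 : ℝ) : ℝ) * Complex.I) =
        Complex.exp (-(ω * (-(1 / 2) : ℝ) : ℝ) * Complex.I) := by
      have h2 : -(((ω * (-(1 / 2) : ℝ) : ℝ)) : ℂ) * Complex.I =
          (((2 * Real.pi * β : ℝ) : ℂ) * Complex.I + -(((ω * (1 / 2 : ℝ) : ℝ)) : ℂ) * Complex.I) + (n : ℂ) * (2 * Real.pi * Complex.I) := by
        rw [hω]; push_cast; ring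
      rw [h2, Complex.exp_add, Complex.exp_add, Complex.exp_int_mul_two_pi_mul_I, mul_one]
    calc Complex.exp (((2 * Real.pi * β : ℝ) : ℂ) * Complex.I) * F (-(1 / 2)) * Complex.exp (-(ω * (1 / 2 : ℝ) : ℝ) * Complex.I) -
          F (-(1 / 2)) * Complex.exp (-(ω * (-(1 / 2) : ℝ) : ℝ) * Complex.I)
        = F (-(1 / 2)) * (Complex.exp (((2 * Real.pi * β : ℝ) : ℂ) * Complex.I) * Complex.exp (-(ω * (1 / 2 : ℝ) : ℝ) * Complex.I)) -
            F (-(1 / 2)) * Complex.exp (-(ω * (-(1 / 2) : ℝ) : ℝ) * Complex.I) := by ring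
      _ = 0 := by rw [e1, sub_self]
  rw [hbd] at hFTC
  -- split the integral of `H'`
  have hsplit : (∫ y in (-(1 / 2 : ℝ))..(1 / 2), H' y) =
      (∫ y in (-(1 / 2 : ℝ))..(1 / 2), F' y * e y) + (-((ω : ℝ) : ℂ) * Complex.I) * ∫ y in (-(1 / 2 : ℝ))..(1 / 2), F y * e y := by
    rw [hH', intervalIntegral.integral_add hI1 hI2, ← intervalIntegral.integral_const_mul]
    congr 1
    refine intervalIntegral.integral_congr fun y _ => ?_
    ring
  rw [hsplit] at hFTC
  have hfin : (∫ y in (-(1 / 2 : ℝ))..(1 / 2), F' y * e y) = ((ω : ℝ) : ℂ) * Complex.I * ∫ y in (-(1 / 2 : ℝ))..(1 / 2), F y * e y := by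
    linear_combination hFTC
  have hωe : ∀ y : ℝ, e y = Complex.exp (-(2 * Real.pi * (β + n) * y : ℝ) * Complex.I) := fun y => by rw [he, hω]
  simp_rw [hωe] at hfin
  rw [hfin, hω]

/-! ## §3 The weighted Bessel inequality and the duality bound -/

/-- A bounded function, a.e.-strongly measurable on `(−½, ½]`, is interval integrable there. [folklore] -/
theorem intervalIntegrable_of_bound_Ioc {g : ℝ → ℂ} {C : ℝ}
    (hg : AEStronglyMeasurable g (volume.restrict (Ioc (-(1 / 2 : ℝ)) (1 / 2)))) (hb : ∀ y, ‖g y‖ ≤ C) :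
    IntervalIntegrable g volume (-(1 / 2 : ℝ)) (1 / 2) := by
  rw [intervalIntegrable_iff_integrableOn_Ioc_of_le (by norm_num)]
  have hL1 : MemLp g 1 (volume.restrict (Ioc (-(1 / 2 : ℝ)) (1 / 2))) := MemLp.of_bound hg C (Filter.Eventually.of_forall hb)
  exact memLp_one_iff_integrable.1 hL1

/-- **The weighted Bessel inequality (Bloch `H¹` form):** for `F` bounded, continuous on `[−½, ½]`, differentiable off a countable set with a bounded
measurable derivative `F'`, and `F(½) = e^{2πiβ}F(−½)`, every finite set of modes satisfies
`Σ_{n∈S} (a² + (β+n)²)·|∫_{−½}^{½} F e^{−2πi(β+n)y}|² ≤ a²·∫_{−½}^{½}|F|² + (1/4π²)·∫_{−½}^{½}|F'|²`. [folklore] -/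
theorem sum_weight_sq_coeff_le {F F' : ℝ → ℂ} {β : ℝ} {T : Set ℝ} {C C' : ℝ} (hT : T.Countable)
    (hF : ContinuousOn F (Icc (-(1 / 2 : ℝ)) (1 / 2))) (hFb : ∀ y, ‖F y‖ ≤ C)
    (hd : ∀ y ∈ Ioo (-(1 / 2 : ℝ)) (1 / 2) \ T, HasDerivAt F (F' y) y)
    (hF'm : AEStronglyMeasurable F' (volume.restrict (Ioc (-(1 / 2 : ℝ)) (1 / 2)))) (hb' : ∀ y, ‖F' y‖ ≤ C')
    (hbloch : F (1 / 2) = Complex.exp (((2 * Real.pi * β : ℝ) : ℂ) * Complex.I) * F (-(1 / 2))) (a : ℝ) (S : Finset ℤ) :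
    ∑ n ∈ S, (a ^ 2 + (β + n) ^ 2) *
        ‖∫ y in (-(1 / 2 : ℝ))..(1 / 2), F y * Complex.exp (-(2 * Real.pi * (β + n) * y : ℝ) * Complex.I)‖ ^ 2 ≤
      a ^ 2 * (∫ y in (-(1 / 2 : ℝ))..(1 / 2), ‖F y‖ ^ 2) + (1 / (4 * Real.pi ^ 2)) * ∫ y in (-(1 / 2 : ℝ))..(1 / 2), ‖F' y‖ ^ 2 := by
  -- `F` is measurable on `(−½, ½]`
  have hFm : AEStronglyMeasurable F (volume.restrict (Ioc (-(1 / 2 : ℝ)) (1 / 2))) :=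
    (hF.mono Ioc_subset_Icc_self).aestronglyMeasurable measurableSet_Ioc
  have hi : IntervalIntegrable F' volume (-(1 / 2 : ℝ)) (1 / 2) := intervalIntegrable_of_bound_Ioc hF'm hb'
  have hB1 := sum_sq_coeff_le_of_bound hFm hFb β S
  have hB2 := sum_sq_coeff_le_of_bound hF'm hb' β S
  -- the mode-by-mode identity `(β+n)²|ĝ_F(n)|² = |ĝ_{F'}(n)|²/(4π²)`
  have hpi : 0 < Real.pi := Real.pi_pos
  have hterm : ∀ n : ℤ, (β + n) ^ 2 * ‖∫ y in (-(1 / 2 : ℝ))..(1 / 2), F y * Complex.exp (-(2 * Real.pi * (β + n) * y : ℝ) * Complex.I)‖ ^ 2 =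
      (1 / (4 * Real.pi ^ 2)) * ‖∫ y in (-(1 / 2 : ℝ))..(1 / 2), F' y * Complex.exp (-(2 * Real.pi * (β + n) * y : ℝ) * Complex.I)‖ ^ 2 := by
    intro n
    rw [← two_pi_mul_coeff_eq_coeff_deriv hT hF hd hi hbloch n]
    set d : ℂ := ∫ y in (-(1 / 2 : ℝ))..(1 / 2), F y * Complex.exp (-(2 * Real.pi * (β + n) * y : ℝ) * Complex.I) with hd_def
    rw [norm_mul, norm_mul, Complex.norm_I, Complex.norm_real, Real.norm_eq_abs, mul_one, mul_pow, sq_abs]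
    field_simp
    ring
  have hsplit : ∑ n ∈ S, (a ^ 2 + (β + n) ^ 2) *
        ‖∫ y in (-(1 / 2 : ℝ))..(1 / 2), F y * Complex.exp (-(2 * Real.pi * (β + n) * y : ℝ) * Complex.I)‖ ^ 2 =
      a ^ 2 * ∑ n ∈ S, ‖∫ y in (-(1 / 2 : ℝ))..(1 / 2), F y * Complex.exp (-(2 * Real.pi * (β + n) * y : ℝ) * Complex.I)‖ ^ 2 +
        (1 / (4 * Real.pi ^ 2)) *
          ∑ n ∈ S, ‖∫ y in (-(1 / 2 : ℝ))..(1 / 2), F' y * Complex.exp (-(2 * Real.pi * (β + n) * y : ℝ) * Complex.I)‖ ^ 2 := by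
    rw [Finset.mul_sum, Finset.mul_sum, ← Finset.sum_add_distrib]
    refine Finset.sum_congr rfl fun n _ => ?_
    rw [add_mul, hterm n]
  rw [hsplit]
  have h4 : 0 ≤ 1 / (4 * Real.pi ^ 2) := by positivity
  exact add_le_add (mul_le_mul_of_nonneg_left hB1 (sq_nonneg a)) (mul_le_mul_of_nonneg_left hB2 h4)

/-- **Weighted Cauchy–Schwarz:** `|Σ_{n∈S} c_n d_n| ≤ √(Σ |c_n|²/w_n) · √(Σ w_n |d_n|²)` for positive weights `w_n = a² + (β+n)²` (`a ≠ 0`). [folklore] -/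
theorem norm_sum_mul_le_sqrt_mul_sqrt {a : ℝ} (ha : a ≠ 0) (β : ℝ) (c d : ℤ → ℂ) (S : Finset ℤ) :
    ‖∑ n ∈ S, c n * d n‖ ≤
      Real.sqrt (∑ n ∈ S, ‖c n‖ ^ 2 / (a ^ 2 + (β + n) ^ 2)) * Real.sqrt (∑ n ∈ S, (a ^ 2 + (β + n) ^ 2) * ‖d n‖ ^ 2) := by
  have hw : ∀ n : ℤ, 0 < a ^ 2 + (β + n) ^ 2 := fun n => by positivity
  set f : ℤ → ℝ := fun n => ‖c n‖ / Real.sqrt (a ^ 2 + (β + n) ^ 2) with hf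
  set g : ℤ → ℝ := fun n => Real.sqrt (a ^ 2 + (β + n) ^ 2) * ‖d n‖ with hg
  have hfg : ∀ n : ℤ, ‖c n‖ * ‖d n‖ = f n * g n := by
    intro n
    have hs : 0 < Real.sqrt (a ^ 2 + (β + n) ^ 2) := Real.sqrt_pos.2 (hw n)
    rw [hf, hg]; dsimp only
    field_simp
  have hf2 : ∀ n : ℤ, f n ^ 2 = ‖c n‖ ^ 2 / (a ^ 2 + (β + n) ^ 2) := by
    intro n; rw [hf]; dsimp only; rw [div_pow, Real.sq_sqrt (hw n).le]
  have hg2 : ∀ n : ℤ, g n ^ 2 = (a ^ 2 + (β + n) ^ 2) * ‖d n‖ ^ 2 := by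
    intro n; rw [hg]; dsimp only; rw [mul_pow, Real.sq_sqrt (hw n).le]
  have h1 : ‖∑ n ∈ S, c n * d n‖ ≤ ∑ n ∈ S, f n * g n := by
    refine (norm_sum_le _ _).trans (le_of_eq (Finset.sum_congr rfl fun n _ => ?_))
    rw [norm_mul, hfg n]
  have hCS := Finset.sum_mul_sq_le_sq_mul_sq S f g
  have h0 : 0 ≤ ∑ n ∈ S, f n * g n := Finset.sum_nonneg fun n _ => by
    rw [← hfg n]; positivity
  have h2 : ∑ n ∈ S, f n * g n ≤ Real.sqrt (∑ n ∈ S, f n ^ 2) * Real.sqrt (∑ n ∈ S, g n ^ 2) := by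
    rw [← Real.sqrt_mul (Finset.sum_nonneg fun n _ => sq_nonneg (f n))]
    exact Real.le_sqrt_of_sq_le hCS
  simp_rw [hf2, hg2] at h2
  exact h1.trans h2

/-- **The duality bound:** under the hypotheses of `sum_weight_sq_coeff_le` and `a ≠ 0`, for every finite set of modes and coefficients `c`,
`|Σ_{n∈S} c_n ∫_{−½}^{½} F e^{−2πi(β+n)y}| ≤ √(Σ_{n∈S} |c_n|²/(a²+(β+n)²)) · √(a²∫|F|² + (1/4π²)∫|F'|²)`. [folklore] -/
theorem norm_sum_mul_coeff_le {F F' : ℝ → ℂ} {β : ℝ} {T : Set ℝ} {C C' : ℝ} (hT : T.Countable)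
    (hF : ContinuousOn F (Icc (-(1 / 2 : ℝ)) (1 / 2))) (hFb : ∀ y, ‖F y‖ ≤ C)
    (hd : ∀ y ∈ Ioo (-(1 / 2 : ℝ)) (1 / 2) \ T, HasDerivAt F (F' y) y)
    (hF'm : AEStronglyMeasurable F' (volume.restrict (Ioc (-(1 / 2 : ℝ)) (1 / 2)))) (hb' : ∀ y, ‖F' y‖ ≤ C')
    (hbloch : F (1 / 2) = Complex.exp (((2 * Real.pi * β : ℝ) : ℂ) * Complex.I) * F (-(1 / 2))) {a : ℝ} (ha : a ≠ 0)
    (c : ℤ → ℂ) (S : Finset ℤ) :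
    ‖∑ n ∈ S, c n * ∫ y in (-(1 / 2 : ℝ))..(1 / 2), F y * Complex.exp (-(2 * Real.pi * (β + n) * y : ℝ) * Complex.I)‖ ≤
      Real.sqrt (∑ n ∈ S, ‖c n‖ ^ 2 / (a ^ 2 + (β + n) ^ 2)) *
        Real.sqrt (a ^ 2 * (∫ y in (-(1 / 2 : ℝ))..(1 / 2), ‖F y‖ ^ 2) + (1 / (4 * Real.pi ^ 2)) * ∫ y in (-(1 / 2 : ℝ))..(1 / 2), ‖F' y‖ ^ 2) := by
  refine (norm_sum_mul_le_sqrt_mul_sqrt ha β c _ S).trans ?_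
  exact mul_le_mul_of_nonneg_left (Real.sqrt_le_sqrt (sum_weight_sq_coeff_le hT hF hFb hd hF'm hb' hbloch a S)) (Real.sqrt_nonneg _)

/-! ## §4 The same for the family `e^{+2πi(b+n)y}` (Bloch condition `F(½) = e^{−2πib}F(−½)`) -/

/-- The `+` family is the `−` family of the reflected class at the reflected index. [folklore] -/
theorem coeff_pos_eq_coeff_neg (F : ℝ → ℂ) (b : ℝ) (n : ℤ) :
    (∫ y in (-(1 / 2 : ℝ))..(1 / 2), F y * Complex.exp ((2 * Real.pi * (b + n) * y : ℝ) * Complex.I)) =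
      ∫ y in (-(1 / 2 : ℝ))..(1 / 2), F y * Complex.exp (-(2 * Real.pi * ((-b) + ((-n : ℤ) : ℝ)) * y : ℝ) * Complex.I) := by
  refine intervalIntegral.integral_congr fun y _ => ?_
  congr 2
  push_cast
  ring

/-- **Weighted Bessel, `+` family:** `Σ_{n∈S} (a² + (b+n)²)|∫F e^{2πi(b+n)y}|² ≤ a²∫|F|² + (1/4π²)∫|F'|²` under the Bloch condition `F(½) = e^{−2πib}F(−½)`.
[folklore] -/
theorem sum_weight_sq_coeff_le_pos {F F' : ℝ → ℂ} {b : ℝ} {T : Set ℝ} {C C' : ℝ} (hT : T.Countable)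
    (hF : ContinuousOn F (Icc (-(1 / 2 : ℝ)) (1 / 2))) (hFb : ∀ y, ‖F y‖ ≤ C)
    (hd : ∀ y ∈ Ioo (-(1 / 2 : ℝ)) (1 / 2) \ T, HasDerivAt F (F' y) y)
    (hF'm : AEStronglyMeasurable F' (volume.restrict (Ioc (-(1 / 2 : ℝ)) (1 / 2)))) (hb' : ∀ y, ‖F' y‖ ≤ C')
    (hbloch : F (1 / 2) = Complex.exp (-((2 * Real.pi * b : ℝ) : ℂ) * Complex.I) * F (-(1 / 2))) (a : ℝ) (S : Finset ℤ) :
    ∑ n ∈ S, (a ^ 2 + (b + n) ^ 2) *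
        ‖∫ y in (-(1 / 2 : ℝ))..(1 / 2), F y * Complex.exp ((2 * Real.pi * (b + n) * y : ℝ) * Complex.I)‖ ^ 2 ≤
      a ^ 2 * (∫ y in (-(1 / 2 : ℝ))..(1 / 2), ‖F y‖ ^ 2) + (1 / (4 * Real.pi ^ 2)) * ∫ y in (-(1 / 2 : ℝ))..(1 / 2), ‖F' y‖ ^ 2 := by
  have hbloch' : F (1 / 2) = Complex.exp (((2 * Real.pi * (-b) : ℝ) : ℂ) * Complex.I) * F (-(1 / 2)) := by
    rw [hbloch]; congr 2; push_cast; ring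
  have h := sum_weight_sq_coeff_le hT hF hFb hd hF'm hb' hbloch' a (S.map (Equiv.neg ℤ).toEmbedding)
  rw [Finset.sum_map] at h
  refine le_of_eq_of_le (Finset.sum_congr rfl fun n _ => ?_) h
  rw [coeff_pos_eq_coeff_neg F b n]
  simp only [Equiv.toEmbedding_apply, Equiv.neg_apply]
  congr 1
  push_cast
  ring

/-- **The duality bound, `+` family:** `|Σ_{n∈S} c_n ∫_{−½}^{½} F e^{2πi(b+n)y}| ≤ √(Σ|c_n|²/(a²+(b+n)²))·√(a²∫|F|² + (1/4π²)∫|F'|²)` under the Bloch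
condition `F(½) = e^{−2πib}F(−½)` (`a ≠ 0`). [folklore] -/
theorem norm_sum_mul_coeff_le_pos {F F' : ℝ → ℂ} {b : ℝ} {T : Set ℝ} {C C' : ℝ} (hT : T.Countable)
    (hF : ContinuousOn F (Icc (-(1 / 2 : ℝ)) (1 / 2))) (hFb : ∀ y, ‖F y‖ ≤ C)
    (hd : ∀ y ∈ Ioo (-(1 / 2 : ℝ)) (1 / 2) \ T, HasDerivAt F (F' y) y)
    (hF'm : AEStronglyMeasurable F' (volume.restrict (Ioc (-(1 / 2 : ℝ)) (1 / 2)))) (hb' : ∀ y, ‖F' y‖ ≤ C')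
    (hbloch : F (1 / 2) = Complex.exp (-((2 * Real.pi * b : ℝ) : ℂ) * Complex.I) * F (-(1 / 2))) {a : ℝ} (ha : a ≠ 0)
    (c : ℤ → ℂ) (S : Finset ℤ) :
    ‖∑ n ∈ S, c n * ∫ y in (-(1 / 2 : ℝ))..(1 / 2), F y * Complex.exp ((2 * Real.pi * (b + n) * y : ℝ) * Complex.I)‖ ≤
      Real.sqrt (∑ n ∈ S, ‖c n‖ ^ 2 / (a ^ 2 + (b + n) ^ 2)) *
        Real.sqrt (a ^ 2 * (∫ y in (-(1 / 2 : ℝ))..(1 / 2), ‖F y‖ ^ 2) + (1 / (4 * Real.pi ^ 2)) * ∫ y in (-(1 / 2 : ℝ))..(1 / 2), ‖F' y‖ ^ 2) := by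
  refine (norm_sum_mul_le_sqrt_mul_sqrt ha b c _ S).trans ?_
  exact mul_le_mul_of_nonneg_left (Real.sqrt_le_sqrt (sum_weight_sq_coeff_le_pos hT hF hFb hd hF'm hb' hbloch a S)) (Real.sqrt_nonneg _)

end Summit.AnomalousDissipation.AnomalousDissipation.Theorems.SawtoothPulseCascade.K2PhaseBudget

end
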